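import Summits.Parity.GeneralizedHardyLittlewood.Theorems.FordMaynardNoSieveConst0164NegWitness0164F3Lower

/-!
# Route `FordMaynardNoSieveConst0164`, crux `NegWitness0164` (stmt-Parity-19102), line `birth`,
# stub `stub_tweakNeg0164`: the family `f_{1,1}(1 - α, α) ≥ -1` (hypothesis (iv₁) discharged)

Helper file toward the certificate stub (K. Ford, J. Maynard, *On the theory of prime producing sieves*,
arXiv:2407.14368, §8, proof of Theorem 2.7 (c):
"`F₄(α) ≥ -2α ∫ 1/(u₁u₂u₃) ≥ -(2α/(ν²(α-2ν))) meas{ν ≤ u₁ ≤ u₂ ≤ u₃, |u| = α} = -2α(α-3ν)²/(12ν²(α-2ν))`").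
In the tree's unordered normalisation: for data with `F₀⁽⁴⁾ ∈ [-1, 0]` the `n = 3` piece of `f_{1,1}(1-α, α)`
satisfies `α N₃ ≥ -α (α - 3ν)²/(6 ν² (α - 2ν))`, `ν = 41/250`, because `|𝓛_{1/2}| ≤ 2` on three pieces,
`v₀v₁v₂ ≥ ν²(α - 2ν)` on `Δ₃(α) ∩ {v ≥ ν}`, and the area of `{v ∈ Δ₃(α) : v ≥ ν}` is `(α - 3ν)²/2`:

* `sliceIntegral_three_indicator_eq_0164` — `∫_{v ∈ Δ₃(α)} 𝟙[v ≥ ν] dv = (α - 3ν)²/2` (`α ≥ 3ν`), by peeling the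
  last coordinate (`sliceIntegral_succ_succ_snoc`) and one interval integral;
* `prod_three_ge_0164` — `v₀v₁v₂ ≥ ν²(α - 2ν)`; `blockWeight_half_three_mul_ge_0164` — `w₃(v)·F ≥ -1/(3 v₀v₁v₂)`
  for `F ∈ [-1, 0]`;
* `alphaN3_ge_0164` — **the bound** `α N₃ ≥ -α(α - 3ν)²/(6ν²(α - 2ν))` for `1/2 ≤ α`, `b = (1 - α)`;
* `poly_ineq_A_0164`, `poly_ineq_B_0164` — the univariate rational inequalities on `[1/2 + ν, 1 - ν]` and
  `[1/2, 1/2 + ν]` (`nlinarith`); `family_one_ge_0164` — **hypothesis (iv₁) `f_{1,1}(1-α, α) ≥ -1` DISCHARGED**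
  for the witness shape (with `…F3Lower`); `stub_tweakNeg0164_of_shape''` — the stub from the shape plus the two
  numerical facts (i) `T₃ + S₅ < -1` and (iv₂) `f_{2,1} ≥ -1`.

Def-free.  References: [FordMaynard2024PrimeSieves] arXiv:2407.14368, §8 (proof of Theorem 2.7 (c), F₄ lower bound).
-/

noncomputable section

open Finset MeasureTheory Set
open scoped Classical
open Literature.Combinatorics.Enumerative
open Literature.NumberTheory.Sieve Literature.NumberTheory.Sieve.FordMaynard

namespace Summit.Parity.GeneralizedHardyLittlewood.FordMaynardNoSieveConst0164NegWitness0164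

/-- For `v : Fin 1 → ℝ`: `snoc (snoc v s) t = (v 0, s, t)`. [folklore] -/
theorem snoc_snoc_fin_one_eq (v : Fin 1 → ℝ) (s t : ℝ) :
    (Fin.snoc (Fin.snoc v s : Fin 2 → ℝ) t : Fin 3 → ℝ) = ![v 0, s, t] := by
  ext i
  fin_cases i
  · rfl
  · rfl
  · rfl

/-- **The inner length**: for `0 < t`, the two-dimensional slice integral of `𝟙[(v, t) ≥ ν]` over `Δ₂(w)` is the
length `max(w - 2ν, 0)` of the window `v₀ ∈ [ν, w - ν]` when `t ≥ ν`, and `0` otherwise (`ν = 41/250`). [folklore] -/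
theorem sliceIntegral_two_indicator_snoc_eq_0164 (w t : ℝ) :
    sliceIntegral 2 w (fun v : Fin 2 → ℝ =>
      if ∀ i, (41 / 250 : ℝ) ≤ (Fin.snoc v t : Fin 3 → ℝ) i then (1 : ℝ) else 0) =
      if (41 / 250 : ℝ) ≤ t then max (w - 2 * (41 / 250)) 0 else 0 := by
  rw [sliceIntegral_succ_eq]
  set S : Set (Fin 1 → ℝ) := Set.pi Set.univ fun _ => Icc (41 / 250 : ℝ) (w - 41 / 250) with hS
  have hval : ∀ u : Fin 1 → ℝ, sliceIntegrand 1 w (fun v : Fin 2 → ℝ =>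
      if ∀ i, (41 / 250 : ℝ) ≤ (Fin.snoc v t : Fin 3 → ℝ) i then (1 : ℝ) else 0) u =
      if (41 / 250 : ℝ) ≤ t then S.indicator (fun _ => (1 : ℝ)) u else 0 := by
    intro u
    unfold sliceIntegrand
    have hcond : (∀ i, (41 / 250 : ℝ) ≤ (Fin.snoc (Fin.snoc u (w - ∑ i, u i) : Fin 2 → ℝ) t : Fin 3 → ℝ) i) ↔
        (41 / 250 : ℝ) ≤ u 0 ∧ (41 / 250 : ℝ) ≤ w - u 0 ∧ (41 / 250 : ℝ) ≤ t := by
      rw [Fin.sum_univ_one, snoc_snoc_fin_one_eq]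
      constructor
      · intro h
        exact ⟨by simpa using h 0, by simpa using h 1, by simpa using h 2⟩
      · intro h i
        fin_cases i
        · simpa using h.1
        · simpa using h.2.1
        · simpa using h.2.2
    have hout : ((∀ i, 0 < u i) ∧ ∑ i, u i < w) ↔ 0 < u 0 ∧ u 0 < w := by
      rw [Fin.sum_univ_one]
      constructor
      · intro h; exact ⟨h.1 0, h.2⟩
      · intro h; exact ⟨fun i => by rw [Subsingleton.elim i 0]; exact h.1, h.2⟩
    simp only [hcond, hout]
    have hmem : u ∈ S ↔ (41 / 250 : ℝ) ≤ u 0 ∧ u 0 ≤ w - 41 / 250 := by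
      rw [hS, Set.mem_univ_pi]
      constructor
      · intro h; exact h 0
      · intro h i; rw [Subsingleton.elim i 0]; exact h
    by_cases ht : (41 / 250 : ℝ) ≤ t
    · rw [if_pos ht]
      by_cases hu : u ∈ S
      · rw [Set.indicator_of_mem hu]
        have h := hmem.1 hu
        rw [if_pos ⟨by linarith [h.1], by linarith [h.2]⟩, if_pos ⟨h.1, by linarith [h.2], ht⟩]
      · rw [Set.indicator_of_notMem hu]
        split_ifs with h1 h2
        · exact absurd (hmem.2 ⟨h2.1, by linarith [h2.2.1]⟩) hu
        · rfl
        · rfl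
    · rw [if_neg ht]
      split_ifs with h1 h2
      · exact absurd h2.2.2 ht
      · rfl
      · rfl
  simp_rw [hval]
  by_cases ht : (41 / 250 : ℝ) ≤ t
  · simp only [if_pos ht]
    rw [integral_indicator (MeasurableSet.univ_pi fun _ => measurableSet_Icc), setIntegral_const,
      smul_eq_mul, mul_one, Measure.real, volume_pi_pi]
    simp only [Real.volume_Icc, Finset.prod_const, Finset.card_univ, Fintype.card_fin, pow_one]
    by_cases hw : 0 ≤ w - 2 * (41 / 250)
    · rw [ENNReal.toReal_ofReal (by linarith), max_eq_left hw]; ring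
    · rw [ENNReal.ofReal_of_nonpos (by linarith), max_eq_right (by linarith)]; simp
  · simp only [if_neg ht, integral_zero]

/-- **The area of `{v ∈ Δ₃(α) : v ≥ ν}` is `(α - 3ν)²/2`** (`α ≥ 3ν`, `ν = 41/250`; slice measure = projection
onto the first two coordinates): Ford–Maynard's "meas{ν ≤ u₁ ≤ u₂ ≤ u₃, |u| = α} = (α - 3ν)²/12" times `3! = 6`.
[cite: FordMaynard2024PrimeSieves, §8 (proof of Theorem 2.7 (c))] -/
theorem sliceIntegral_three_indicator_eq_0164 {α : ℝ} (hα : 3 * (41 / 250) ≤ α) :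
    sliceIntegral 3 α (fun v : Fin 3 → ℝ => if ∀ i, (41 / 250 : ℝ) ≤ v i then (1 : ℝ) else 0) =
      (α - 3 * (41 / 250)) ^ 2 / 2 := by
  have hmeas : Measurable (fun v : Fin 3 → ℝ => if ∀ i, (41 / 250 : ℝ) ≤ v i then (1 : ℝ) else 0) := by
    refine Measurable.ite ?_ measurable_const measurable_const
    have h : {v : Fin 3 → ℝ | ∀ i, (41 / 250 : ℝ) ≤ v i} = ⋂ i, {v | (41 / 250 : ℝ) ≤ v i} := by
      ext v; simp
    rw [h]
    exact MeasurableSet.iInter fun i => measurableSet_le measurable_const (measurable_pi_apply i)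
  rw [sliceIntegral_succ_succ_snoc 1 α hmeas zero_le_one (fun v _ _ => by split_ifs <;> simp)]
  show (∫ t in Ioc (0 : ℝ) α, sliceIntegral 2 (α - t) (fun v : Fin 2 → ℝ =>
    if ∀ i, (41 / 250 : ℝ) ≤ (Fin.snoc v t : Fin 3 → ℝ) i then (1 : ℝ) else 0)) = _
  simp_rw [sliceIntegral_two_indicator_snoc_eq_0164]
  -- the integrand is the indicator of `[ν, α - 2ν]` times the linear function `α - 2ν - t`
  have hfun : ∀ t ∈ Ioc (0 : ℝ) α, (if (41 / 250 : ℝ) ≤ t then max (α - t - 2 * (41 / 250)) 0 else 0) =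
      (Icc (41 / 250 : ℝ) (α - 2 * (41 / 250))).indicator (fun t => α - 2 * (41 / 250) - t) t := by
    intro t _
    by_cases h : t ∈ Icc (41 / 250 : ℝ) (α - 2 * (41 / 250))
    · rw [Set.indicator_of_mem h, if_pos h.1, max_eq_left (by linarith [h.2])]; ring
    · rw [Set.indicator_of_notMem h]
      by_cases ht : (41 / 250 : ℝ) ≤ t
      · rw [if_pos ht, max_eq_right]
        by_contra hc
        push Not at hc
        exact h ⟨ht, by linarith⟩
      · rw [if_neg ht]
  rw [setIntegral_congr_fun measurableSet_Ioc hfun, setIntegral_indicator measurableSet_Icc,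
    show Ioc (0 : ℝ) α ∩ Icc (41 / 250 : ℝ) (α - 2 * (41 / 250)) = Icc (41 / 250 : ℝ) (α - 2 * (41 / 250)) from
      Set.inter_eq_right.2 fun t ht => ⟨by linarith [ht.1], by linarith [ht.2]⟩,
    integral_Icc_eq_integral_Ioc, ← intervalIntegral.integral_of_le (by linarith),
    intervalIntegral.integral_sub (continuous_const.intervalIntegrable _ _)
      (continuous_id'.intervalIntegrable _ _),
    intervalIntegral.integral_const, integral_id]
  simp only [smul_eq_mul]
  ring

/-- **`v₀v₁v₂ ≥ ν²(α - 2ν)`** for `v ≥ ν` with `v₀ + v₁ + v₂ = α` (the product is smallest at `(ν, ν, α - 2ν)`).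
[cite: FordMaynard2024PrimeSieves, §8 ("1/(u₁u₂u₃) ≤ 1/(ν²(α−2ν))")] -/
theorem prod_three_ge_0164 (v : Fin 3 → ℝ) (hv : ∀ i, (41 / 250 : ℝ) ≤ v i) {α : ℝ} (hs : ∑ i, v i = α) :
    (41 / 250 : ℝ) ^ 2 * (α - 2 * (41 / 250)) ≤ v 0 * v 1 * v 2 := by
  rw [Fin.sum_univ_three] at hs
  have h0 := hv 0; have h1 := hv 1; have h2 := hv 2
  have h01 : (41 / 250 : ℝ) * (v 0 + v 1 - 41 / 250) ≤ v 0 * v 1 := by nlinarith [mul_nonneg (sub_nonneg.2 h0) (sub_nonneg.2 h1)]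
  have hs' : (41 / 250 : ℝ) * (α - 2 * (41 / 250)) ≤ (v 0 + v 1 - 41 / 250) * v 2 := by
    nlinarith [mul_nonneg (by linarith : (0 : ℝ) ≤ v 0 + v 1 - 41 / 250 - 41 / 250) (sub_nonneg.2 h2)]
  nlinarith [mul_le_mul_of_nonneg_right h01 (by linarith : (0 : ℝ) ≤ v 2)]

/-- **`|𝓛_{1/2}| ≤ 2` on three pieces, in the form `w₃(v)·F ≥ -1/(3 v₀v₁v₂)` for `F ∈ [-1, 0]`** (`v > 0`,
`|v| ≥ 1/2`): if all pieces are `< 1/2` then `𝓛 = 2 − #{pairs < 1/2} ∈ [-1, 2]`, otherwise `𝓛 = 0`.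
[cite: FordMaynard2024PrimeSieves, §8 ("if k = 3 then 𝓛_{1/2}(u) = 2 − #{…} ≤ 2")] -/
theorem blockWeight_half_three_mul_ge_0164 (v : Fin 3 → ℝ) (hpos : ∀ i, 0 < v i) {α : ℝ} (hs : ∑ i, v i = α)
    (hα : 1 / 2 ≤ α) {F : ℝ} (hF : -1 ≤ F ∧ F ≤ 0) :
    -(1 / (3 * (v 0 * v 1 * v 2))) ≤ blockWeight (1 / 2) 3 v * F := by
  rw [Fin.sum_univ_three] at hs
  have h0 := hpos 0; have h1 := hpos 1; have h2 := hpos 2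
  have hprod : 0 < v 0 * v 1 * v 2 := by positivity
  by_cases hlt : ∀ i, v i < 1 / 2
  · have hL := linnikFn_three_eq (c := 1 - 1 / 2) v (fun i => by linarith [hlt i]) (by linarith)
    have hLle : linnikFn (1 - 1 / 2) v Finset.univ ≤ 2 := by
      rw [hL]; split_ifs <;> norm_num
    have hLge : -1 ≤ linnikFn (1 - 1 / 2) v Finset.univ := by
      rw [hL]; split_ifs <;> norm_num
    unfold blockWeight
    rw [Fin.prod_univ_three, show (Nat.factorial 3 : ℝ) = 6 from by norm_num [Nat.factorial]]
    set L := linnikFn (1 - 1 / 2) v Finset.univ with hLdef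
    rw [div_mul_eq_mul_div, show -(1 / (3 * (v 0 * v 1 * v 2))) = (-2 : ℝ) / (6 * (v 0 * v 1 * v 2)) from by
      field_simp; norm_num]
    refine div_le_div_of_nonneg_right ?_ (by positivity)
    by_cases hL0 : 0 ≤ L
    · nlinarith [mul_nonneg hL0 (by linarith : 0 ≤ F + 1)]
    · push Not at hL0
      nlinarith [mul_nonneg_of_nonpos_of_nonpos hL0.le hF.2]
  · push Not at hlt
    obtain ⟨i, hi⟩ := hlt
    unfold blockWeight
    rw [linnikFn_eq_zero_of_mem (1 - 1 / 2) v (Finset.mem_univ i) (by linarith) fun k _ => (hpos k).le, zero_div,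
      zero_mul, neg_nonpos]
    positivity

/-- **Ford–Maynard's volume bound for the `n = 3` piece of `f_{1,1}`**: for data `F₀` piecewise Lipschitz in each
dimension with `F₀⁽⁴⁾ ∈ [-1, 0]`, `α ≥ 1/2` and any `b ∈ ℝ¹`,
`α ∫_{v ∈ Δ₃(α)} 𝟙[v ≥ ν] w₃(v) F₀(v, b) dv ≥ -α(α - 3ν)²/(6ν²(α - 2ν))` (`ν = 41/250`).
[cite: FordMaynard2024PrimeSieves, §8 (proof of Theorem 2.7 (c): "F₄(α) ≥ −2α(α−3ν)²/(12ν²(α−2ν))")] -/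
theorem alphaN3_ge_0164 {F₀ : VecFn} (hpl : ∀ k, IsPiecewiseLipschitz (F₀ k))
    (h4 : ∀ x : Fin 4 → ℝ, -1 ≤ F₀ 4 x ∧ F₀ 4 x ≤ 0) {α : ℝ} (hα : 1 / 2 ≤ α) (b : Fin 1 → ℝ) :
    -(α * (α - 3 * (41 / 250)) ^ 2 / (6 * (41 / 250) ^ 2 * (α - 2 * (41 / 250)))) ≤
      α * sliceIntegral 3 α (fun v => if ∀ t, (41 / 250 : ℝ) ≤ v t then
        blockWeight (1 / 2) 3 v * F₀ (3 + 1) (Fin.append v b) else 0) := by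
  have hα2 : 0 < α - 2 * (41 / 250) := by linarith
  set C : ℝ := 1 / (3 * ((41 / 250 : ℝ) ^ 2 * (α - 2 * (41 / 250)))) with hC
  have hC0 : 0 < C := by positivity
  set G : (Fin 3 → ℝ) → ℝ := fun v => if ∀ t, (41 / 250 : ℝ) ≤ v t then
    blockWeight (1 / 2) 3 v * F₀ (3 + 1) (Fin.append v b) else 0 with hG
  set P : (Fin 3 → ℝ) → ℝ := fun v => C * (if ∀ i, (41 / 250 : ℝ) ≤ v i then (1 : ℝ) else 0) with hP
  have hset : MeasurableSet {v : Fin 3 → ℝ | ∀ t, (41 / 250 : ℝ) ≤ v t} := by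
    have h : {v : Fin 3 → ℝ | ∀ i, (41 / 250 : ℝ) ≤ v i} = ⋂ i, {v | (41 / 250 : ℝ) ≤ v i} := by
      ext v; simp
    rw [h]
    exact MeasurableSet.iInter fun i => measurableSet_le measurable_const (measurable_pi_apply i)
  have hGm : Measurable G := Measurable.ite hset
    ((measurable_blockWeight _ _).mul ((hpl _).measurable.comp (measurable_append_left b))) measurable_const
  have hPm : Measurable P := measurable_const.mul (Measurable.ite hset measurable_const measurable_const)
  -- pointwise on the slice: `G + P ≥ 0`, `|G| ≤ B`, `|P| ≤ C`
  set B : ℝ := 3 * (2 ^ 3) ^ 3 / (41 / 250 : ℝ) ^ 3 + C with hB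
  have hstep : ∀ v : Fin 3 → ℝ, (∀ i, 0 < v i) → ∑ i, v i = α → 0 ≤ G v + P v ∧ |G v| ≤ B ∧ |P v| ≤ B := by
    intro v hv hvs
    simp only [hG, hP]
    by_cases hc : ∀ t, (41 / 250 : ℝ) ≤ v t
    · rw [if_pos hc, if_pos hc, mul_one]
      have hprod := prod_three_ge_0164 v hc hvs
      have hw := blockWeight_half_three_mul_ge_0164 v hv hvs hα (h4 (Fin.append v b))
      have hpp : 0 < v 0 * v 1 * v 2 := by have := hv 0; have := hv 1; have := hv 2; positivity
      refine ⟨?_, ?_, ?_⟩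
      · have : 1 / (3 * (v 0 * v 1 * v 2)) ≤ C := by
          rw [hC]
          exact one_div_le_one_div_of_le (by positivity) (by nlinarith)
        linarith
      · rw [abs_mul]
        have h1 : |blockWeight (1 / 2) 3 v| ≤ 3 * (2 ^ 3) ^ 3 / (41 / 250 : ℝ) ^ 3 :=
          abs_blockWeight_le (by norm_num) 3 v hc
        have h2 : |F₀ (3 + 1) (Fin.append v b)| ≤ 1 := abs_le.2 ⟨(h4 _).1, by linarith [(h4 (Fin.append v b)).2]⟩
        calc |blockWeight (1 / 2) 3 v| * |F₀ (3 + 1) (Fin.append v b)|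
            ≤ 3 * (2 ^ 3) ^ 3 / (41 / 250 : ℝ) ^ 3 * 1 := mul_le_mul h1 h2 (abs_nonneg _) (by positivity)
          _ ≤ B := by rw [hB, mul_one]; linarith
      · rw [abs_of_pos hC0, hB]
        have : (0 : ℝ) ≤ 3 * (2 ^ 3) ^ 3 / (41 / 250 : ℝ) ^ 3 := by positivity
        linarith
    · rw [if_neg hc, if_neg hc, mul_zero, abs_zero]
      exact ⟨by norm_num, by positivity, by positivity⟩
  have hadd := sliceIntegral_add 2 α hGm hPm (C := B) (by positivity) (fun v hv hvs => (hstep v hv hvs).2.1)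
    (fun v hv hvs => (hstep v hv hvs).2.2)
  have hnn : 0 ≤ sliceIntegral 3 α (fun v => G v + P v) :=
    sliceIntegral_nonneg_of _ _ _ fun v hv hvs => (hstep v hv hvs).1
  have hPint : sliceIntegral 3 α P = C * ((α - 3 * (41 / 250)) ^ 2 / 2) := by
    rw [hP, sliceIntegral_const_mul, sliceIntegral_three_indicator_eq_0164 (by linarith)]
  rw [hadd, hPint] at hnn
  have hα0 : 0 ≤ α := by linarith
  have key : -(C * ((α - 3 * (41 / 250)) ^ 2 / 2)) ≤ sliceIntegral 3 α G := by linarith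
  have hCeq : α * (C * ((α - 3 * (41 / 250)) ^ 2 / 2)) =
      α * (α - 3 * (41 / 250)) ^ 2 / (6 * (41 / 250) ^ 2 * (α - 2 * (41 / 250))) := by
    rw [hC]
    field_simp
    ring
  rw [← hCeq]
  nlinarith [mul_le_mul_of_nonneg_left key hα0]

/-- The univariate inequality closing `f_{1,1} ≥ -1` on `α ∈ [1/2 + ν, 1 - ν]`:
`2(1-α)/α - α(α-3ν)²/(6ν²(α-2ν)) ≥ -1` (`ν = 41/250`; minimum `≈ -0.814` at `α = 1 - ν`). [folklore] -/
theorem poly_ineq_A_0164 {a : ℝ} (h1 : 1 / 2 + 41 / 250 ≤ a) (h2 : a ≤ 1 - 41 / 250) :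
    -1 ≤ 2 * (1 - a) / a - a * (a - 3 * (41 / 250)) ^ 2 / (6 * (41 / 250) ^ 2 * (a - 2 * (41 / 250))) := by
  have ha : 0 < a := by linarith
  have ha2 : 0 < a - 2 * (41 / 250) := by linarith
  have key : 0 ≤ 6 * (41 / 250 : ℝ) ^ 2 * (2 - a) * (a - 2 * (41 / 250)) - a ^ 2 * (a - 3 * (41 / 250)) ^ 2 := by
    nlinarith [mul_nonneg (sub_nonneg.2 h1) (sub_nonneg.2 h2),
      mul_nonneg (mul_nonneg (sub_nonneg.2 h1) (sub_nonneg.2 h2)) (sub_nonneg.2 h2),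
      mul_nonneg (mul_nonneg (sub_nonneg.2 h1) (sub_nonneg.2 h2)) (sub_nonneg.2 h1)]
  have hD : 0 < 6 * (41 / 250 : ℝ) ^ 2 * (a - 2 * (41 / 250)) := by positivity
  rw [div_sub_div _ _ ha.ne' hD.ne', le_div_iff₀ (by positivity)]
  nlinarith [key]

/-- The univariate inequality closing `f_{1,1} ≥ -1` on `α ∈ [1/2, 1/2 + ν]`:
`2(α-2ν)/α - α(α-3ν)²/(6ν²(α-2ν)) ≥ -1` (`ν = 41/250`). [folklore] -/
theorem poly_ineq_B_0164 {a : ℝ} (h1 : 1 / 2 ≤ a) (h2 : a ≤ 1 / 2 + 41 / 250) :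
    -1 ≤ 2 * (a - 2 * (41 / 250)) / a - a * (a - 3 * (41 / 250)) ^ 2 / (6 * (41 / 250) ^ 2 * (a - 2 * (41 / 250))) := by
  have ha : 0 < a := by linarith
  have ha2 : 0 < a - 2 * (41 / 250) := by linarith
  have key : 0 ≤ 6 * (41 / 250 : ℝ) ^ 2 * (3 * a - 4 * (41 / 250)) * (a - 2 * (41 / 250)) -
      a ^ 2 * (a - 3 * (41 / 250)) ^ 2 := by
    nlinarith [mul_nonneg (sub_nonneg.2 h1) (sub_nonneg.2 h2),
      mul_nonneg (mul_nonneg (sub_nonneg.2 h1) (sub_nonneg.2 h2)) (sub_nonneg.2 h2),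
      mul_nonneg (mul_nonneg (sub_nonneg.2 h1) (sub_nonneg.2 h2)) (sub_nonneg.2 h1)]
  have hD : 0 < 6 * (41 / 250 : ℝ) ^ 2 * (a - 2 * (41 / 250)) := by positivity
  rw [div_sub_div _ _ ha.ne' hD.ne', le_div_iff₀ (by positivity)]
  nlinarith [key]

/-- **Hypothesis (iv₁) discharged: `f_{1,1}(1 - α, α) ≥ -1`** for data `F₀` piecewise Lipschitz in each
dimension with `F₀⁽³⁾ = -1` at the small vectors of the support and `F₀⁽⁴⁾ ∈ [-1, 0]`: for every
`b ∈ [41/250, 1/2)^1`, with `α = 1 - b₀`, `α (N₂ + N₃) ≥ -1` (Ford–Maynard: "`f_{1,1}(1-α,α) ≥ … ≥ -0.911`"; here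
with the rational bounds `αN₂ ≥ 2(1-α)/α` resp. `2(α-2ν)/α` and `αN₃ ≥ -α(α-3ν)²/(6ν²(α-2ν))`, minimum `≈ -0.814`).
[cite: FordMaynard2024PrimeSieves, §8 (proof of Theorem 2.7 (c): "f_{1,1}(1−α,α) ≥ log(…) − α(α−3ν)²/(6ν²(α−2ν)) ≥ −0.911")] -/
theorem family_one_ge_0164 {F₀ : VecFn} (hpl : ∀ k, IsPiecewiseLipschitz (F₀ k))
    (h3eq : ∀ x : Fin 3 → ℝ, (∀ i, (41 / 250 : ℝ) ≤ x i) → (∀ i, x i < 1 / 2) → ∑ i, x i = 1 → F₀ 3 x = -1)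
    (h4 : ∀ x : Fin 4 → ℝ, -1 ≤ F₀ 4 x ∧ F₀ 4 x ≤ 0)
    (b : Fin 1 → ℝ) (hb : ∀ i, (41 / 250 : ℝ) ≤ b i) (hb' : ∀ i, b i < 1 / 2) :
    -1 ≤ (1 - ∑ i, b i) *
      (sliceIntegral 2 (1 - ∑ i, b i) (fun v => if ∀ t, (41 / 250 : ℝ) ≤ v t then
          blockWeight (1 / 2) 2 v * F₀ (2 + 1) (Fin.append v b) else 0) +
        sliceIntegral 3 (1 - ∑ i, b i) (fun v => if ∀ t, (41 / 250 : ℝ) ≤ v t then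
          blockWeight (1 / 2) 3 v * F₀ (3 + 1) (Fin.append v b) else 0)) := by
  have hsum : ∑ i, b i = b 0 := Fin.sum_univ_one b
  have hb0 := hb 0
  have hb0' := hb' 0
  have hN3 := alphaN3_ge_0164 hpl h4 (α := 1 - ∑ i, b i) (by rw [hsum]; linarith) b
  rw [mul_add]
  by_cases hcase : b 0 ≤ 1 / 2 - 41 / 250
  · have hN2 := alphaN2_ge_0164 h3eq b hb0 hcase
    have hp := poly_ineq_A_0164 (a := 1 - ∑ i, b i) (by rw [hsum]; linarith) (by rw [hsum]; linarith)
    have : 2 * (1 - (1 - ∑ i, b i)) / (1 - ∑ i, b i) = 2 * (∑ i, b i) / (1 - ∑ i, b i) := by ring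
    linarith
  · push Not at hcase
    have hN2 := alphaN2_ge_0164' h3eq b hcase.le hb0'
    have hp := poly_ineq_B_0164 (a := 1 - ∑ i, b i) (by rw [hsum]; linarith) (by rw [hsum]; linarith)
    linarith

/-- **`stub_tweakNeg0164` from the witness shape and TWO numerical inequalities.** Let `F₀ ∈ 𝒮` be piecewise
Lipschitz in each dimension, supported on `{ξᵢ ≥ 41/250, Σ ξ = 1}`, with `F₀⁽³⁾ = -1` at the small vectors of the
support and `F₀⁽³⁾ ∈ [-1, 0]` everywhere, `F₀⁽⁴⁾ ∈ [-1, 0]`, `F₀⁽⁵⁾ ≥ 0` vanishing at vectors with a pair `≥ 1/2`,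
`F₀⁽⁶⁾ = 0` (Ford–Maynard's §8 shape; the cell's LP class R). If
(i) `T₃(F₀) + S₅(F₀) < -1` (the value at `(1)`), and
(iv₂) for every `b ∈ [41/250, 1/2)^2` with `|b| ≤ 1/2`, `α = 1 - |b|`: `α (A + B) ≥ -1` (`f_{2,1} ≥ -1`, the binding
family), then `F₀` witnesses `stub_tweakNeg0164` verbatim — hypotheses (ii), (iii), (iv₁) and the families `s ≥ 3`
are discharged (`hsmall_of_shape_0164`, `hhalf_0164`, `family_one_ge_0164`, `families_high_eq_zero_0164`).
[cite: FordMaynard2024PrimeSieves, §8 (proof of Theorem 2.7 (c))] -/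
theorem stub_tweakNeg0164_of_shape'' (F₀ : VecFn) (hs : F₀.IsSymmetric)
    (hpl : ∀ k, IsPiecewiseLipschitz (F₀ k))
    (hsupp : ∀ (k : ℕ) (ξ : Fin k → ℝ), F₀ k ξ ≠ 0 → (∀ i, (41 / 250 : ℝ) ≤ ξ i) ∧ ∑ i, ξ i = 1)
    (h3eq : ∀ x : Fin 3 → ℝ, (∀ i, (41 / 250 : ℝ) ≤ x i) → (∀ i, x i < 1 / 2) → ∑ i, x i = 1 → F₀ 3 x = -1)
    (h3 : ∀ x : Fin 3 → ℝ, -1 ≤ F₀ 3 x ∧ F₀ 3 x ≤ 0) (h4 : ∀ x : Fin 4 → ℝ, -1 ≤ F₀ 4 x ∧ F₀ 4 x ≤ 0)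
    (h5 : ∀ x : Fin 5 → ℝ, 0 ≤ F₀ 5 x)
    (hpair : ∀ (x : Fin 5 → ℝ) (i j : Fin 5), i ≠ j → 1 / 2 ≤ x i + x j → F₀ 5 x = 0)
    (h6 : ∀ x : Fin 6 → ℝ, F₀ 6 x = 0)
    (hone : sliceIntegral 3 1 (fun v => if (∀ t, (41 / 250 : ℝ) ≤ v t) ∧ (∀ t, v t < 1 / 2) then
          F₀ 3 v / (3 * (v 0 * v 1 * v 2)) else 0) +
        sliceIntegral 5 1
          (fun v => if ∀ t, (41 / 250 : ℝ) ≤ v t then blockWeight (1 / 2) 5 v * F₀ 5 v else 0) < -1)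
    (h2 : ∀ b : Fin 2 → ℝ, (∀ i, (41 / 250 : ℝ) ≤ b i) → (∀ i, b i < 1 / 2) → ∑ i, b i ≤ 1 / 2 →
      -1 ≤ (1 - ∑ i, b i) *
        (sliceIntegral 2 (1 - ∑ i, b i) (fun v => if ∀ t, (41 / 250 : ℝ) ≤ v t then
            blockWeight (1 / 2) 2 v * F₀ (2 + 2) (Fin.append v b) else 0) +
          sliceIntegral 3 (1 - ∑ i, b i) (fun v => if ∀ t, (41 / 250 : ℝ) ≤ v t then
            blockWeight (1 / 2) 3 v * F₀ (3 + 2) (Fin.append v b) else 0))) :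
    ∃ F₀ : VecFn, F₀.IsSymmetric ∧ (∀ k, IsPiecewiseLipschitz (F₀ k)) ∧
      (∀ (k : ℕ) (ξ : Fin k → ℝ), F₀ k ξ ≠ 0 → (∀ i, (41 / 250 : ℝ) ≤ ξ i) ∧ ∑ i, ξ i = 1) ∧
      tweak (1 / 2) (41 / 250) Fin.elim0 Fin.elim0 F₀ 1 (fun _ => 1) < -1 ∧
      ∀ k : ℕ, 2 ≤ k → ∀ β : Fin k → ℝ, -1 ≤ tweak (1 / 2) (41 / 250) Fin.elim0 Fin.elim0 F₀ k β :=
  stub_tweakNeg0164_of_shape' F₀ hs hpl hsupp h3 h4 h5 hpair h6 hone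
    (fun b hb hb' => family_one_ge_0164 hpl h3eq h4 b hb hb') h2

end Summit.Parity.GeneralizedHardyLittlewood.FordMaynardNoSieveConst0164NegWitness0164

end
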